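import Mathlib.CategoryTheory.Galois.Prorepresentability
import Literature.AnabelianGeometry.SemiGraphs.FiniteEtaleCoveringDictionary
import Literature.AnabelianGeometry.SemiGraphs.CommensurableTerminalityLemmas
import Literature.AnabelianGeometry.SemiGraphs.SingleVertexSubgraph
import Literature.AnabelianGeometry.SemiGraphs.BouquetCriteria
import Literature.AnabelianGeometry.Anabelioids.FiberFunctorUnique
import Literature.AnabelianGeometry.Anabelioids.ExactFunctorProofs
import Literature.AnabelianGeometry.SemiGraphs.CoverticialVertexCaseTools
import Literature.AnabelianGeometry.SemiGraphs.PreimageComponentLemmas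
import Literature.AnabelianGeometry.SemiGraphs.GraphOfAnabelioidsGalois

/-!
# [SemiAnbd] Corollary 2.7 (i) (commensurable terminality) from Proposition 2.6 and the covering dictionary

Mochizuki, *Semi-graphs of anabelioids*, Publ. RIMS **42** (2006) 221–322, §2, Corollary 2.7 (i),
author's manuscript p. 30 [cite: MochizukiSemiAnbd2006, Cor. 2.7(i) p.30]: for a connected,
quasi-coherent graph of anabelioids `𝒢` and a connected sub-semi-graph `ℍ` all of whose vertices are
elevated, "`C_{Π_𝒢}(Π_ℍ) = Π_ℍ`.  In particular, if `v` is an elevated vertex of `𝒢`, then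
`C_{Π_𝒢}(Π_v) = Π_v`."  This file proves the REDUCTION of the named fact `corollary_2_7_i`
(`Commensurability.lean`) to the named facts it rests on — exactly the printed proof (p. 30):

> Suppose that `g ∈ C_{Π_𝒢}(Π_ℍ)`, but `g ∉ Π_ℍ`.  Then there exists a connected finite Galois
> étale covering `𝒢′ → 𝒢` — whose restriction to `ℍ` … we denote by `ℋ′ → ℍ` — satisfying the
> property that there exists a connected component `ℋ″` of `ℋ′` such that `g · ℋ″ ≠ ℋ″` in `𝒢′`.
> Since [as one verifies immediately] `ℋ′` injects into `𝒢′` as a subgraph, it thus follows that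
> `g · ℋ″ ∩ ℋ″ = ∅` [in `𝒢′`].  Thus, assertion (i) follows from Proposition 2.6.

Inputs, BY NAME: `proposition_2_6` (abc-iut-L3-d1), `exists_finiteEtaleCoveringGlobal` (Def. 2.2 (i)
existence WITH the global clause `B(𝒢′) = B(𝒢)_{/A}` and branch alignment, rulings ζ2/μ2/π2 —
abc-iut-L3-t5/t6), the finite étale covering dictionary (v4: vertex/branch-aligned, UNTIED group
clauses — rulings ρ2/ψ2) (D1, D3, D5, D6, D8, D9 of `FiniteEtaleCoveringDictionary.lean`; D0 is
DISCHARGED here, `covering_fiberFunctor_holds`), the structural lemma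
`Hom.IsPreimageComponent.eq_of_verts_eq` (`PreimageComponentLemmas.lean`), and
abc-iut-L3-t9's theorem `bOf_galoisCategory_holds` (`B(𝒢)` is a Galois category, `ρ_v ⋙ β` fibre
functors).  Steps: `g ∉ Π_ℍ` closed ⇒ open normal `N` with `g ∉ Π_ℍ N`
(`exists_openNormalSubgroup_forall_mul_ne`) ⇒ pointed Galois object `(A, a)` with `Stab(a) ⊆ N`
(Mathlib `nhds_one_has_basis_stabilizers`) ⇒ covering `𝒢′` attached to `A` (locally, globally and branch-aligned, ζ2/μ2), connected (D8),
a graph, quasi-coherent (D5), with a vertex `v′` over `v ∈ ℍ` (D9) elevated (D6), basepoints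
aligned (D0 + fibre-functor uniqueness, L6-t18's `nonempty_iso_of_fiberFunctor'`) ⇒ `Π′ = Stab` (D1, all stabilisers equal for Galois `A`)
⇒ the components `K` of `φ⁻¹(ℍ)` are as many as the double cosets `Π_ℍ \ Π_𝒢 / Π′` and each has
group `ι(Π_K) = Π′ ∩ g_K⁻¹Π_ℍ g_K` for some `g_K` (D3, untied form).  PIGEONHOLE (the step print
leaves implicit in "the component corresponding to `g`"): `K ↦ Π_ℍ g_K Π′` is INJECTIVE — equal
double cosets give `Π_{𝒢′}`-conjugate component groups, which Proposition 2.6 in `𝒢′` forbids for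
distinct components (distinct components have distinct vertex sets, `eq_of_verts_eq`) — hence
surjective: a component `𝕂″` sits at the double coset of `g`, and `𝕂″ ∌ v′` since `g ∉ Π_ℍ Π′`.
Proposition 2.6 for `(ℋ″ ∋ v′, 𝕂″)`: `[Π_{ℋ″} : Π_{ℋ″} ∩ γΠ_{𝕂″}γ⁻¹] = ∞` for all `γ ∈ Π_{𝒢′}` ⇒
with `γ` cancelling the `Π′`-ambiguity, `[Π′ ∩ Π_ℍ : Π′ ∩ Π_ℍ ∩ g⁻¹Π_ℍ g] = ∞`, contradicting
`g⁻¹ ∈ C(Π_ℍ)`.  The vertex clause follows via `Π_{{v}} = Π_v` (`SingleVertexSubgraph.lean`).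
Nothing here takes a side on [IUTchIII] Cor. 3.12.
-/

namespace Literature.AnabelianGeometry.SemiGraphs

open CategoryTheory CategoryTheory.PreGaloisCategory
open Literature.AnabelianGeometry.Anabelioids
open scoped Pointwise

universe w v₁ u₁ u

/-! (Basepoint transports in any universe: `nonempty_iso_of_fiberFunctor'` of
`CoverticialVertexCaseTools.lean`, abc-iut-L6-t18.) -/

namespace SemiGraphOfAnabelioids

/-! ### A finite étale covering of a graph of anabelioids is a graph of anabelioids -/

/-- A proper morphism into a graph has a graph as source: verticial cardinalities are preserved,
so every edge of the source has both branches abutting. [cite: MochizukiSemiAnbd2006, Def. 2.1 p.22] -/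
theorem isGraphOfAnabelioids_of_isProper {𝒢 𝒢' : SemiGraphOfAnabelioids.{v₁, u₁, u}}
    (φ : Hom 𝒢' 𝒢) (hφ : SemiGraph.IsProper φ.base) (hg : 𝒢.IsGraphOfAnabelioids) :
    𝒢'.IsGraphOfAnabelioids := by
  refine ⟨⟨fun b => ?_⟩⟩
  have h2 : 𝒢'.graph.vertCard (𝒢'.graph.edgeOf b) = 2 := by
    rw [← hφ, hg.isGraph.vertCard_eq_two]
  rw [SemiGraph.vertCard, Nat.card_eq_two_iff] at h2
  obtain ⟨x, y, hxy, hxyu⟩ := h2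
  obtain ⟨b₁, b₂, hne, h₁, h₂, hall⟩ := 𝒢'.graph.two_branches (𝒢'.graph.edgeOf b)
  -- `b`, `x.1`, `y.1` are branches of the same edge; `x.1 ≠ y.1`, so `b ∈ {x.1, y.1}`
  have hb : b = x.1 ∨ b = y.1 := by
    rcases hall b rfl with hb | hb <;> rcases hall x.1 x.2.1 with hx | hx <;>
      rcases hall y.1 y.2.1 with hy | hy
    all_goals first
      | exact Or.inl (hb.trans hx.symm)
      | exact Or.inr (hb.trans hy.symm)
      | exact absurd (Subtype.ext (hx.trans hy.symm)) hxy
  rcases hb with hb | hb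
  · rw [hb]; exact x.2.2
  · rw [hb]; exact y.2.2

/-! ### The one-vertex sub-semi-graph is a graph -/

/-- The one-vertex edgeless sub-semi-graph `{v}` has no branches, hence is (vacuously) a graph —
the RQ10 guard of `corollary_2_7_i` for `ℍ = {v}`. [cite: MochizukiSemiAnbd2006, Prop. 2.5 p.27] -/
theorem single_isGraph (𝒢 : SemiGraphOfAnabelioids.{v₁, u₁, u}) (v : 𝒢.graph.Vertex) :
    (⟨{v}, ∅⟩ : 𝒢.graph.Subgraph).toSemiGraph.IsGraph :=
  ⟨fun b => b.2.elim⟩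

/-! ### (D0) discharged: the induced basepoint is a fibre functor -/

/-- **(D0) `covering_fiberFunctor` holds**: the basepoint `φ_{v′}^* ⋙ F′` of `𝒢_v` induced from a
basepoint of a constituent of a finite étale covering is a fibre functor — immediately from the
exactness of `φ_{v′}^*` (abc-iut-L3-t9's `fiberFunctor_comp_of_exact`), as abc-iut-L6-t17 observed
(INBOX 21:52:42Z). [cite: MochizukiSemiAnbd2006, Def. 2.2(i) p.23] -/
theorem covering_fiberFunctor_holds : covering_fiberFunctor.{v₁, u₁, u} :=
  fun _ _ φ _ _ _ v' F' _ => ⟨fiberFunctor_comp_of_exact (φ.φV v').pullback F'⟩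

/-! ### The reduction -/

section Reduction

variable (h26 : proposition_2_6.{v₁, u₁, u}) (hex : exists_finiteEtaleCoveringGlobal.{v₁, u₁, u})
  (hD1 : covering_decompositionGroup.{v₁, u₁, u})
  (hD3 : covering_subgraphComponents_doubleCosets.{v₁, u₁, u})
  (hD5 : covering_isQuasiCoherent.{v₁, u₁, u}) (hD6 : covering_isElevated.{v₁, u₁, u})
  (hD8 : covering_isConnected.{v₁, u₁, u}) (hD9 : covering_vertexMap_surjective.{v₁, u₁, u})

include h26 hex hD1 hD3 hD5 hD6 hD8 hD9 in
/-- **The sub-semi-graph clause of Cor. 2.7 (i), from Prop. 2.6 and the covering dictionary**: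
for `𝒢` a connected quasi-coherent graph of anabelioids, `ℍ ∋ v` a connected sub-semi-graph all of
whose vertices are elevated, and any basepoint through `v`, the image `Π_ℍ ⊆ Π_𝒢` is commensurably
terminal.  (The printed proof, p. 30, formalised step by step; see the module docstring.)
[cite: MochizukiSemiAnbd2006, Cor. 2.7(i) p.30] -/
theorem isCommensurablyTerminal_piHToPi_of_dictionary
    (𝒢 : SemiGraphOfAnabelioids.{v₁, u₁, u}) (hc : 𝒢.IsConnected) (hg : 𝒢.IsGraphOfAnabelioids)
    (hq : 𝒢.IsQuasiCoherent) (H : 𝒢.graph.Subgraph) (hH : H.toSemiGraph.IsConnected)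
    (hHg : H.toSemiGraph.IsGraph) (hel : ∀ w : H.toSemiGraph.Vertex, 𝒢.IsElevated w.1)
    (v : 𝒢.graph.Vertex) (hvH : v ∈ H.verts) (F : 𝒢.V v ⥤ FintypeCat.{v₁}) [FiberFunctor F] :
    AbsoluteAnabelian.IsCommensurablyTerminal (𝒢.piHToPi H ⟨v, hvH⟩ F).range := by
  set PH : Subgroup (𝒢.Pi v F) := (𝒢.piHToPi H ⟨v, hvH⟩ F).range with hPH
  refine ⟨le_antisymm ?_ (le_commensurator_self PH)⟩
  intro g hgC
  by_contra hgPH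
  -- (1) an open normal subgroup `N` with `g ∉ Π_ℍ N`
  obtain ⟨N, hN⟩ := exists_openNormalSubgroup_forall_mul_ne PH
    (isClosed_range_piHToPi 𝒢 H ⟨v, hvH⟩ F) hgPH
  -- (2) `B(𝒢)` is a Galois category, `ρ_v ⋙ F` a fibre functor
  obtain ⟨instG, hfib⟩ := bOf_galoisCategory_holds 𝒢 hc
  letI := instG
  obtain ⟨instF⟩ := hfib v F
  -- (3) a pointed Galois object `(A, a)` with `Stab(a) ⊆ N`
  obtain ⟨X, -, hX⟩ := (nhds_one_has_basis_stabilizers (𝒢.ρ v ⋙ F)).mem_iff.1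
    (N.toOpenSubgroup.isOpen.mem_nhds (one_mem N))
  haveI : IsGalois X.obj := X.isGalois
  -- (4) the covering attached to `A := X.obj`
  obtain ⟨𝒢', φ, hφ, hB, hal, hva⟩ := hex 𝒢 hc ⟨v⟩ X.obj
  have hc' : 𝒢'.IsConnected := hD8 𝒢 𝒢' φ X.obj hc hφ inferInstance
  have hg' : 𝒢'.IsGraphOfAnabelioids := isGraphOfAnabelioids_of_isProper φ hφ.1 hg
  have hq' : 𝒢'.IsQuasiCoherent := hD5 𝒢 𝒢' φ X.obj hc hc' hφ hal hq
  -- (5) a vertex `v'` over `v`, basepoints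
  obtain ⟨v', hv'⟩ := hD9 𝒢 𝒢' φ X.obj hc hφ inferInstance v
  subst hv'
  let F' : 𝒢'.V v' ⥤ FintypeCat.{v₁} := GaloisCategory.getFiberFunctor (𝒢'.V v')
  obtain ⟨instFF⟩ := covering_fiberFunctor_holds 𝒢 𝒢' φ X.obj hc hφ v' F'
  obtain ⟨e⟩ := nonempty_iso_of_fiberFunctor ((φ.φV v').pullback ⋙ F') F
  have hel' : 𝒢'.IsElevated v' := hD6 𝒢 𝒢' φ X.obj hc hc' hφ hB hal hq v' (hel ⟨_, hvH⟩)
  -- (6) decomposition group `Π' = Stab(x₀) = Stab(a) ⊆ N`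
  obtain ⟨x₀, hinj, hrange⟩ := hD1 𝒢 𝒢' φ X.obj hc hc' hφ hB v' F' F e
  -- (7) the components of `φ⁻¹(ℍ)` ↔ `Π_ℍ \ Π_𝒢 / Π'`
  obtain ⟨d, hbij, ⟨K₀, hK₀⟩, hbase, hgrp⟩ :=
    hD3 𝒢 𝒢' φ X.obj hc hc' hφ hB hva v' F' F e H hH hHg hvH x₀ hrange
  -- the covering homomorphism `ι : Π_{𝒢'} → Π_𝒢`
  set ι : 𝒢'.Pi v' F' →* 𝒢.Pi (φ.base.vertexMap v') F :=
    (Aut.autMulEquivOfIso (Functor.isoWhiskerLeft (𝒢.ρ (φ.base.vertexMap v')) e)).toMonoidHom.comp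
      (pi1Map φ.pullbackFunctor (𝒢'.ρ v' ⋙ F')) with hι
  have hstab : MulAction.stabilizer (𝒢.Pi (φ.base.vertexMap v') F) x₀ =
      MulAction.stabilizer (𝒢.Pi (φ.base.vertexMap v') F) X.pt :=
    stabilizer_eq_of_isGalois (𝒢.ρ (φ.base.vertexMap v') ⋙ F) X.obj x₀ X.pt
  have hPiN : ∀ q ∈ ι.range, q ∈ N := fun q hq => by
    apply hX
    rw [← hstab, ← hrange]
    exact hq
  obtain ⟨-, hQ₀⟩ := hbase K₀ hK₀
  have hgN : ∀ p ∈ PH, ∀ q ∈ ι.range, g ≠ p * 1 * q := fun p hp q hq hgeq =>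
    hN p hp q (hPiN q hq) (by rw [hgeq, mul_one])
  -- every vertex of a component is elevated (D6)
  have helev : ∀ (K : {K : 𝒢'.graph.Subgraph // φ.IsPreimageComponent H K}) (u : 𝒢'.graph.Vertex),
      u ∈ K.1.verts → 𝒢'.IsElevated u := fun K u hu =>
    hD6 𝒢 𝒢' φ X.obj hc hc' hφ hB hal hq u (hel ⟨_, K.2.2.2.2.1 hu⟩)
  -- (8) a reading of the group of each component: `ι(Π_K) = Π' ∩ g_K⁻¹ Π_ℍ g_K` (untied (D3)),
  --     with `g_K = 1` when `v' ∈ K` (base clause)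
  obtain ⟨instG', hfib'⟩ := bOf_galoisCategory_holds 𝒢' hc'
  have hread : ∀ K : {K : 𝒢'.graph.Subgraph // φ.IsPreimageComponent H K},
      ∃ (w : K.1.toSemiGraph.Vertex) (F'' : 𝒢'.V w.1 ⥤ FintypeCat.{v₁}) (_ : FiberFunctor F'')
        (α : 𝒢'.ρ w.1 ⋙ F'' ≅ 𝒢'.ρ v' ⋙ F') (g₁ : 𝒢.Pi (φ.base.vertexMap v') F),
        (ι.comp ((Aut.autMulEquivOfIso α).toMonoidHom.comp (𝒢'.piHToPi K.1 w F''))).range =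
            ι.range ⊓ ConjAct.toConjAct g₁⁻¹ • PH ∧ (v' ∈ K.1.verts → g₁ = 1) := by
    intro K
    by_cases hK : v' ∈ K.1.verts
    · refine ⟨⟨v', hK⟩, F', inferInstance, Iso.refl _, 1, ?_, fun _ => rfl⟩
      have hid : (Aut.autMulEquivOfIso (Iso.refl (𝒢'.ρ v' ⋙ F'))).toMonoidHom = MonoidHom.id _ := by
        ext f : 1
        apply Aut.ext
        simp [Aut.autMulEquivOfIso]
      rw [hid, MonoidHom.id_comp, (hbase K hK).2, inv_one, map_one, one_smul]
    · obtain ⟨w, hw⟩ := K.2.2.2.1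
      let F'' : 𝒢'.V w ⥤ FintypeCat.{v₁} := GaloisCategory.getFiberFunctor (𝒢'.V w)
      obtain ⟨α⟩ : Nonempty (𝒢'.ρ w ⋙ F'' ≅ 𝒢'.ρ v' ⋙ F') := by
        letI := instG'
        obtain ⟨i1⟩ := hfib' w F''
        obtain ⟨i2⟩ := hfib' v' F'
        exact nonempty_iso_of_fiberFunctor' _ _
      obtain ⟨g₁, hg₁⟩ := hgrp K ⟨w, hw⟩ F'' α
      exact ⟨⟨w, hw⟩, F'', inferInstance, α, g₁, hg₁, fun h => absurd h hK⟩
  choose wK FK instK αK gK hgK hgK1 using hread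
  -- (9) KEY (Prop. 2.6): two components with a vertex of the first outside the second have
  --     readings in DISTINCT double cosets `Π_ℍ g_K Π'`
  have hkey : ∀ K K' : {K : 𝒢'.graph.Subgraph // φ.IsPreimageComponent H K},
      (∃ u ∈ K.1.verts, u ∉ K'.1.verts) →
      DoubleCoset.mk PH ι.range (gK K) = DoubleCoset.mk PH ι.range (gK K') → False := by
    intro K K' ⟨u, huK, huK'⟩ hcl
    haveI := instK K
    haveI := instK K'
    rw [DoubleCoset.eq] at hcl
    obtain ⟨p, hp, q, hq, hgeq⟩ := hcl
    obtain ⟨γ, hγ⟩ : ∃ γ : 𝒢'.Pi v' F', ι γ = q⁻¹ := ι.range.inv_mem hq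
    -- the two readings, as subgroups of `Π_{𝒢'}`
    set AK : Subgroup (𝒢'.Pi v' F') :=
      ((Aut.autMulEquivOfIso (αK K)).toMonoidHom.comp (𝒢'.piHToPi K.1 (wK K) (FK K))).range
      with hAK
    set AK' : Subgroup (𝒢'.Pi v' F') :=
      ((Aut.autMulEquivOfIso (αK K')).toMonoidHom.comp (𝒢'.piHToPi K'.1 (wK K') (FK K'))).range
      with hAK'
    have hA : AK.map ι = ι.range ⊓ ConjAct.toConjAct (gK K)⁻¹ • PH := by
      rw [hAK, ← MonoidHom.range_comp]; exact hgK K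
    have hA' : AK'.map ι = ι.range ⊓ ConjAct.toConjAct (gK K')⁻¹ • PH := by
      rw [hAK', ← MonoidHom.range_comp]; exact hgK K'
    -- `ι(A_{K'}) = q⁻¹ ι(A_K) q`, hence `A_{K'} = γ A_K γ⁻¹`
    have hconjA : AK' = ConjAct.toConjAct γ • AK := by
      apply Subgroup.map_injective hinj
      rw [map_conjAct_smul, hγ, hA, hA', hgeq, mul_inv_rev, mul_inv_rev, map_mul, map_mul,
        mul_smul, mul_smul, conjAct_smul_eq_self_of_mem (PH.inv_mem hp), Subgroup.smul_inf,
        conjAct_smul_eq_self_of_mem (ι.range.inv_mem hq)]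
    -- Prop. 2.6 for the pair `(K, K')` at the basepoints `(w_K, F_K)`, `(w_{K'}, F_{K'})`
    obtain ⟨hrel, -⟩ := h26 𝒢' hc' hg' hq' K.1 K'.1 K.2.1 K'.2.1 K.2.2.1 K'.2.2.1
      (Or.inl ⟨u, huK, huK', helev K u huK⟩) (wK K) (FK K) (wK K') (FK K')
      (αK K' ≪≫ (αK K).symm)
    -- transport to `Π_{𝒢'}` along `T := Aut(α_K)`
    set T := Aut.autMulEquivOfIso (αK K) with hT
    have hTcomp : T.toMonoidHom.comp (Aut.autMulEquivOfIso (αK K' ≪≫ (αK K).symm)).toMonoidHom =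
        (Aut.autMulEquivOfIso (αK K')).toMonoidHom := by
      ext f : 1
      apply Aut.ext
      simp [hT, Aut.autMulEquivOfIso]
    have hPK : ((𝒢'.piHToPi K.1 (wK K) (FK K)).range).map T.toMonoidHom = AK := by
      rw [hAK, ← MonoidHom.range_comp]
    have hPK' : (((Aut.autMulEquivOfIso (αK K' ≪≫ (αK K).symm)).toMonoidHom.comp
        (𝒢'.piHToPi K'.1 (wK K') (FK K'))).range).map T.toMonoidHom = AK' := by
      rw [hAK', ← MonoidHom.range_comp, ← MonoidHom.comp_assoc, hTcomp]
    -- `P_{K'} = δ P_K δ⁻¹` with `δ := T⁻¹ γ`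
    have hδ : ((Aut.autMulEquivOfIso (αK K' ≪≫ (αK K).symm)).toMonoidHom.comp
        (𝒢'.piHToPi K'.1 (wK K') (FK K'))).range =
        ConjAct.toConjAct (T.symm γ) • (𝒢'.piHToPi K.1 (wK K) (FK K)).range := by
      apply Subgroup.map_injective (f := T.toMonoidHom) T.injective
      rw [hPK', map_conjAct_smul, hPK, hconjA]
      simp [hT]
    have h0 := hrel (T.symm γ)⁻¹
    rw [hδ, smul_smul, ← map_mul, inv_mul_cancel, map_one, one_smul, Subgroup.relIndex_self]
      at h0
    exact one_ne_zero h0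
  -- (10) the readings give an INJECTIVE, hence (by the counting bijection `d`) SURJECTIVE map to
  --      the double cosets; pick the component `K₁` at the double coset of `g`
  have hcinj : Function.Injective
      (fun K : {K : 𝒢'.graph.Subgraph // φ.IsPreimageComponent H K} =>
        DoubleCoset.mk PH ι.range (gK K)) := by
    intro K K' hcl
    by_contra hne
    by_cases h1 : ∃ u ∈ K.1.verts, u ∉ K'.1.verts
    · exact hkey K K' h1 hcl
    by_cases h2 : ∃ u ∈ K'.1.verts, u ∉ K.1.verts
    · exact hkey K' K h2 hcl.symm
    push Not at h1 h2
    exact hne (Subtype.ext (K.2.eq_of_verts_eq K'.2 (Set.Subset.antisymm h1 h2)))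
  haveI : ι.range.FiniteIndex := by
    rw [hrange]
    refine ⟨?_⟩
    rw [MulAction.index_stabilizer]
    exact Nat.pos_iff_ne_zero.mp
      ((Set.ncard_pos (Set.toFinite _)).mpr ⟨x₀, MulAction.mem_orbit_self x₀⟩)
  haveI : Finite (DoubleCoset.Quotient (PH : Set (𝒢.Pi (φ.base.vertexMap v') F)) ι.range) := by
    refine Finite.of_surjective
      (fun x : 𝒢.Pi (φ.base.vertexMap v') F ⧸ ι.range =>
        Quotient.liftOn' x (DoubleCoset.mk PH ι.range) ?_) ?_
    · intro a b hab
      rw [QuotientGroup.leftRel_apply] at hab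
      exact (DoubleCoset.eq PH ι.range a b).2
        ⟨1, PH.one_mem, a⁻¹ * b, hab, by rw [one_mul, mul_inv_cancel_left]⟩
    · intro x
      induction x using Quotient.inductionOn' with
      | h a => exact ⟨QuotientGroup.mk a, rfl⟩
  haveI : Finite {K : 𝒢'.graph.Subgraph // φ.IsPreimageComponent H K} :=
    (Equiv.ofBijective _ hbij).finite_iff.mpr inferInstance
  obtain ⟨K₁, hK₁⟩ := ((Finite.injective_iff_surjective_of_equiv (Equiv.ofBijective _ hbij)).mp
    hcinj) (DoubleCoset.mk PH ι.range g)
  have hK₁' : DoubleCoset.mk PH ι.range (gK K₁) = DoubleCoset.mk PH ι.range g := hK₁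
  -- `v' ∉ K₁`: otherwise `g_{K₁} = 1` and `g ∈ Π_ℍ Π' ⊆ Π_ℍ N`
  have hv'K₁ : v' ∉ K₁.1.verts := by
    intro hmem
    have h2 := hK₁'
    rw [hgK1 K₁ hmem, DoubleCoset.eq] at h2
    obtain ⟨p, hp, q, hq, hgeq⟩ := h2
    exact hgN p hp q hq hgeq
  -- (11) the reading of `K₁`: `ι(Π_{K₁}) = Π' ∩ g₁⁻¹ Π_ℍ g₁` with `g = p₁ g₁ q₁`
  haveI := instK K₁
  have hQ₁ := hgK K₁
  have hg₁' := hK₁'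
  rw [DoubleCoset.eq] at hg₁'
  obtain ⟨p₁, hp₁, q₁, hq₁, hgeq₁⟩ := hg₁'
  -- (12) Proposition 2.6 in `𝒢'` for the components `K₀ ∋ v'` and `K₁ ∌ v'`
  have h26' := h26 𝒢' hc' hg' hq' K₀.1 K₁.1 K₀.2.1 K₁.2.1 K₀.2.2.1 K₁.2.2.1
    (Or.inl ⟨v', hK₀, hv'K₁, hel'⟩) ⟨v', hK₀⟩ F' (wK K₁) (FK K₁) (αK K₁)
  obtain ⟨hrel, -⟩ := h26'
  -- (13) choose `γ ∈ Π_{𝒢'}` with `ι γ = q₁⁻¹` and push the relative index through `ι`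
  obtain ⟨γ, hγ⟩ : ∃ γ : 𝒢'.Pi v' F', ι γ = q₁⁻¹ := ι.range.inv_mem hq₁
  have hzero := hrel γ
  rw [← Subgroup.relIndex_map_map_of_injective _ _ hinj, map_conjAct_smul, hγ,
    ← MonoidHom.range_comp, ← MonoidHom.range_comp, hQ₁, hQ₀] at hzero
  -- (14) … contradicting the commensurability of `g⁻¹ Π_ℍ g` with `Π_ℍ`
  have hcomm : (ConjAct.toConjAct g⁻¹ • PH).relIndex PH ≠ 0 :=
    ((Subgroup.Commensurable.commensurator_mem_iff PH g⁻¹).1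
      ((Subgroup.Commensurable.commensurator PH).inv_mem hgC)).1
  exact relIndex_conj_inter_ne_zero PH ι.range hp₁ hq₁ hgeq₁ hcomm hzero

include h26 hex hD1 hD3 hD5 hD6 hD8 hD9 in
/-- **[SemiAnbd] Corollary 2.7 (i), reduced to Proposition 2.6 and the finite étale covering
dictionary**: the named fact `corollary_2_7_i` (both clauses: `C_{Π_𝒢}(Π_ℍ) = Π_ℍ` for connected
`ℍ` with elevated vertices, and `C_{Π_𝒢}(Π_v) = Π_v` for elevated `v`) follows from
`proposition_2_6`, `exists_finiteEtaleCoveringGlobal` and the dictionary facts (D1), (D3), (D5), (D6),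
(D8), (D9) ((D0) being discharged above); the vertex clause is the sub-semi-graph clause for `ℍ = {v}`
(`range_piHToPi_single`). [cite: MochizukiSemiAnbd2006, Cor. 2.7(i) p.30] -/
theorem corollary_2_7_i_of_dictionary : corollary_2_7_i.{v₁, u₁, u} := by
  intro 𝒢 hc hg hq
  refine ⟨fun H hH hHg hel w F _ => ?_, fun v hv F _ => ?_⟩
  · exact isCommensurablyTerminal_piHToPi_of_dictionary h26 hex hD1 hD3 hD5 hD6 hD8 hD9
      𝒢 hc hg hq H hH hHg hel w.1 w.2 F
  · have h := isCommensurablyTerminal_piHToPi_of_dictionary h26 hex hD1 hD3 hD5 hD6 hD8 hD9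
      𝒢 hc hg hq ⟨{v}, ∅⟩ (single_isConnected 𝒢 v) (single_isGraph 𝒢 v) (fun w => ?_) v
      (Set.mem_singleton v) F
    · rwa [range_piHToPi_single] at h
    · obtain ⟨w, hw⟩ := w
      cases hw
      exact hv

end Reduction

end SemiGraphOfAnabelioids

end Literature.AnabelianGeometry.SemiGraphs
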